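import Literature.NumberTheory.Sieve.HeathBrownWeightFourthMoment
import Literature.NumberTheory.Sieve.CubicClassBoxTransfer
import Mathlib.Analysis.SpecialFunctions.Pow.Asymptotics
import HarnessLib

/-!
# Class counts of Heath-Brown pairs from above, via a containing Heath-Brown–Moroz box, PROVED

Topic `Literature/NumberTheory/Sieve`, namespace `Literature.NumberTheory.Sieve.CubicMinorant`
(continuation of `CubicClassBoxTransfer.lean`, `HeathBrownWeightFourthMoment.lean`).

Upper bounds for the class counts `P_N(a,b) = #{(x, y) ∈ primePairs(X, η) : x ≡ a, y ≡ b (mod d)}`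
(`X = (N/6)^{1/3}`, `η = (log X)^{−c}`, `a, b < d`) need NO sieve: Heath-Brown's box `(X, X(1+η)]²`,
restricted to the class, is CONTAINED in the Heath-Brown–Moroz box of scale `X' = (X − max(a,b))/d`
in the coordinates `x = a + du`, `y = b + dv` (`residueClassPrimeCount_eq_card_classPairs`), because
the latter has relative width `η' = (log X')^{−c} > η` — by a margin `≫ Xη/log X` that absorbs the
corner shift (`card_class_le_residueClassPrimeCount`, `eventually_box_top_le`).  Hence the class
asymptotic `residueClassPrimeCount X' η' d a b = w(d) M(X')(1 + o(1))` [HeathBrownMoroz2004, Thm 2] and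
`M(X')d²/M(X) → 1` give `P_N(a, b) ≤ (w(d) + ε) M(X)/d²` for `N ≥ N₀(ε)`
(`card_class_le_of_classAsymptotic`).  Lower bounds then follow for the route's class SUMS from
`∑_r U_d(r) = U` and `∑_r ρ(d, r) = 1` (no sieve either) — see the parity-ideate blueprint
`CLASS-TRANSFER-BLUEPRINT.md`.  No new facts.  Written for the parity-ideate cell (literature seat
g14, 2026-08-27).

## References

* [HeathBrownMoroz2004] D. R. Heath-Brown, B. Z. Moroz, Proc. LMS (3) 88 (2004), Theorem 2, §1 (1.2).
* [HeathBrownActa2001] D. R. Heath-Brown, Acta Math. 186 (2001), Theorem 1.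
-/

noncomputable section

open Finset Filter Topology Asymptotics
open Literature.NumberTheory.Sieve.CubicPrimes

namespace Literature.NumberTheory.Sieve.CubicMinorant

/-! ### Containment of the class in a Heath-Brown–Moroz box -/

/-- **The class of Heath-Brown's box lies in the HBM box of scale `(X − max(a,b))/d`** once the top
condition `Xη + max(a,b) ≤ (X − max(a,b))η'` holds: then
`#{(x,y) ∈ primePairs X η : x ≡ a, y ≡ b} ≤ residueClassPrimeCount ((X − max(a,b))/d) η' d a b`.
[cite: HeathBrownMoroz2004, §1 (1.2) (f(x⃗) = N(γ + d x⃗))] -/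
theorem card_class_le_residueClassPrimeCount {d a b : ℕ} (hd : 0 < d) (ha : a < d) (hb : b < d)
    {X η η' : ℝ} (htop : X * η + ((max a b : ℕ) : ℝ) ≤ (X - ((max a b : ℕ) : ℝ)) * η') :
    #{xy ∈ primePairs X η | xy.1 ≡ a [MOD d] ∧ xy.2 ≡ b [MOD d]} ≤
      residueClassPrimeCount ((X - ((max a b : ℕ) : ℝ)) / d) η' d a b := by
  rw [residueClassPrimeCount_eq_card_classPairs hd ha hb]
  set M : ℝ := ((max a b : ℕ) : ℝ) with hM
  have hd' : (0 : ℝ) < d := by exact_mod_cast hd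
  have haM : (a : ℝ) ≤ M := by rw [hM]; exact_mod_cast le_max_left a b
  have hbM : (b : ℝ) ≤ M := by rw [hM]; exact_mod_cast le_max_right a b
  have ha0 : (0 : ℝ) ≤ a := Nat.cast_nonneg a
  have hb0 : (0 : ℝ) ≤ b := Nat.cast_nonneg b
  have e1 : ∀ e : ℝ, e + d * ((X - M) / d) = e + (X - M) := fun e => by field_simp
  have e2 : ∀ e : ℝ, e + d * ((X - M) / d * (1 + η')) = e + (X - M) * (1 + η') := fun e => by
    field_simp
  refine card_le_card fun xy hxy => ?_
  obtain ⟨x, y⟩ := xy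
  rw [mem_filter] at hxy
  obtain ⟨hmem, hxa, hyb⟩ := hxy
  obtain ⟨hx1, hx2, hy1, hy2, hcop, hpr⟩ := mem_primePairs_iff.mp hmem
  have hxt : (x : ℝ) ≤ a + d * ((X - M) / d * (1 + η')) := by rw [e2]; nlinarith
  have hyt : (y : ℝ) ≤ b + d * ((X - M) / d * (1 + η')) := by rw [e2]; nlinarith
  simp only [mem_filter, mem_product, mem_Iic]
  refine ⟨⟨Nat.le_floor hxt, Nat.le_floor hyt⟩, hxa, hyb, ⟨?_, hxt⟩, ⟨?_, hyt⟩, hcop, hpr⟩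
  · rw [e1]; linarith
  · rw [e1]; linarith

/-! ### The top condition holds eventually -/

/-- Bernoulli for a negative power: `(1 − s)^{−c} ≥ 1 + cs` for `0 ≤ s < 1`, `0 ≤ c`. [folklore] -/
private theorem one_add_mul_le_one_sub_rpow_neg {s c : ℝ} (hs1 : s < 1) (hc : 0 ≤ c) :
    1 + c * s ≤ (1 - s) ^ (-c) := by
  have h1 : 0 < 1 - s := by linarith
  rw [Real.rpow_def_of_pos h1]
  have hlog : Real.log (1 - s) ≤ -s := by
    have := Real.log_le_sub_one_of_pos h1; linarith
  calc 1 + c * s ≤ c * s + 1 := by ring_nf; rfl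
    _ ≤ Real.exp (c * s) := Real.add_one_le_exp _
    _ ≤ Real.exp (Real.log (1 - s) * -c) := Real.exp_le_exp.mpr (by nlinarith)

/-- `K · log X ≤ X η` eventually (`η = (log X)^{−c}`): every power of `log X` is `o(X)`.
[cite: HeathBrownActa2001, Theorem 1 (η = (log X)^{−c})] -/
theorem eventually_mul_log_le_hbX_mul_hbEta (c K : ℝ) :
    ∀ᶠ N : ℕ in atTop, K * Real.log (hbX N) ≤ hbX N * hbEta c N := by
  -- `(log X)^{c+1} ≤ X / (|K| + 1)` eventually, from `(log x)^{c+1} = o(x)`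
  have hlo := isLittleO_log_rpow_rpow_atTop (c + 1) (show (0 : ℝ) < 1 by norm_num)
  have hK : 0 < |K| + 1 := by positivity
  have hev := hlo.bound (show (0 : ℝ) < 1 / (|K| + 1) by positivity)
  have hev2 : ∀ᶠ x : ℝ in atTop, Real.exp 1 ≤ x := eventually_ge_atTop _
  filter_upwards [tendsto_hbX.eventually hev, tendsto_hbX.eventually hev2] with N hN hN1
  have hX0 : 0 < hbX N := lt_of_lt_of_le (Real.exp_pos 1) hN1
  have hL1 : 1 ≤ Real.log (hbX N) := by
    rw [← Real.log_exp 1]; exact Real.log_le_log (Real.exp_pos 1) hN1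
  have hL0 : 0 < Real.log (hbX N) := by linarith
  rw [Real.rpow_one, Real.norm_of_nonneg (Real.rpow_nonneg hL0.le _),
    Real.norm_of_nonneg hX0.le] at hN
  -- `K log X ≤ (|K|+1) log X = (|K|+1) (log X)^{c+1} η ≤ X η`
  unfold hbEta
  have hsplit : Real.log (hbX N) = Real.log (hbX N) ^ (c + 1) * Real.log (hbX N) ^ (-c) := by
    rw [← Real.rpow_add hL0]; norm_num
  have hη0 : 0 ≤ Real.log (hbX N) ^ (-c) := Real.rpow_nonneg hL0.le _
  calc K * Real.log (hbX N) ≤ (|K| + 1) * Real.log (hbX N) := by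
        nlinarith [le_abs_self K, hL0]
    _ = (|K| + 1) * Real.log (hbX N) ^ (c + 1) * Real.log (hbX N) ^ (-c) := by
        rw [mul_assoc, ← hsplit]
    _ ≤ hbX N * Real.log (hbX N) ^ (-c) := by
        refine mul_le_mul_of_nonneg_right ?_ hη0
        have := mul_le_mul_of_nonneg_left hN hK.le
        have e : (|K| + 1) * (1 / (|K| + 1) * hbX N) = hbX N := by field_simp
        linarith [this, e]

/-- **The top condition eventually**: for `d ≥ 1` and `M < d`,
`Xη + M ≤ (X − M) · (log((X − M)/d))^{−c}` for all large `N` (`X = hbX N`, `η = hbEta c N`):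
for `d ≥ 2` the HBM box is relatively wider by `η'/η − 1 ≥ c log 2/log X`, and `Xη/log X → ∞`.
[cite: HeathBrownMoroz2004, §1 (1.2) with HeathBrownActa2001, Theorem 1] -/
theorem eventually_box_top_le {c : ℝ} (hc : 0 < c) {d M : ℕ} (hd : 0 < d) (hM : M < d) :
    ∀ᶠ N : ℕ in atTop,
      hbX N * hbEta c N + (M : ℝ) ≤ (hbX N - M) * Real.log ((hbX N - M) / d) ^ (-c) := by
  rcases Nat.lt_or_ge d 2 with hd1 | hd2
  · -- `d = 1`, `M = 0`: equality
    have hM0 : M = 0 := by omega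
    subst hM0
    have hd1' : d = 1 := by omega
    subst hd1'
    refine Eventually.of_forall fun N => ?_
    simp [hbEta]
  · have hd' : (2 : ℝ) ≤ d := by exact_mod_cast hd2
    have hM' : (0 : ℝ) ≤ M := Nat.cast_nonneg M
    -- the quantitative input: `(M(2+c)/(c log 2)) · log X ≤ X η`, and `X` large
    have hK := eventually_mul_log_le_hbX_mul_hbEta c (((M : ℝ) * (2 + c) + 1) / (c * Real.log 2))
    have hbig : ∀ᶠ N : ℕ in atTop, 2 * ((M : ℝ) + 1) * d ≤ hbX N :=
      tendsto_hbX.eventually (eventually_ge_atTop _)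
    have hbig2 : ∀ᶠ N : ℕ in atTop, Real.exp (2 * Real.log 2) + M ≤ hbX N :=
      tendsto_hbX.eventually (eventually_ge_atTop _)
    have hηev : ∀ᶠ N : ℕ in atTop, hbEta c N ≤ 1 :=
      (tendsto_hbEta hc).eventually (eventually_le_nhds one_pos)
    filter_upwards [hK, hbig, hbig2, hηev] with N hKN hXbig hXbig2 hη1
    have hlog2 : 0 < Real.log 2 := Real.log_pos (by norm_num)
    have hd0 : (0 : ℝ) < d := by linarith
    have hX0 : 0 < hbX N := by nlinarith
    have hXM : Real.exp (2 * Real.log 2) ≤ hbX N - M := by linarith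
    have hXM0 : 0 < hbX N - M := lt_of_lt_of_le (Real.exp_pos _) hXM
    set X := hbX N with hXdef
    set L := Real.log X with hLdef
    -- `log X ≥ log (X − M) ≥ 2 log 2`
    have hL2 : 2 * Real.log 2 ≤ Real.log (X - M) := by
      rw [← Real.log_exp (2 * Real.log 2)]; exact Real.log_le_log (Real.exp_pos _) hXM
    have hLM : Real.log (X - M) ≤ L := Real.log_le_log hXM0 (by linarith)
    have hL0 : 0 < L := by linarith
    -- `X' = (X − M)/d ≤ (X − M)/2`, so `log X' ≤ log(X − M) − log 2 ≤ L − log 2`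
    have hX'0 : 0 < (X - M) / d := div_pos hXM0 hd0
    have hlogX' : Real.log ((X - M) / d) ≤ L - Real.log 2 := by
      rw [Real.log_div hXM0.ne' hd0.ne']
      have : Real.log 2 ≤ Real.log d := Real.log_le_log (by norm_num) hd'
      linarith
    have hX'1 : 0 < Real.log ((X - M) / d) := by
      -- `(X − M)/d ≥ 2(M+1)d/d − … ≥ 1`: from `2(M+1)d ≤ X` get `X − M ≥ d + … > d`
      apply Real.log_pos
      rw [lt_div_iff₀ hd0, one_mul]
      nlinarith
    -- `η' ≥ (L − log 2)^{−c} = L^{−c} (1 − log2/L)^{−c} ≥ η (1 + c log2/L)`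
    have hs1 : Real.log 2 / L < 1 := by rw [div_lt_one hL0]; linarith
    have hη' : L ^ (-c) * (1 + c * (Real.log 2 / L)) ≤ Real.log ((X - M) / d) ^ (-c) := by
      have h1 : (L - Real.log 2) ^ (-c) ≤ Real.log ((X - M) / d) ^ (-c) :=
        Real.rpow_le_rpow_of_nonpos hX'1 hlogX' (by linarith)
      have h2 : (L - Real.log 2) ^ (-c) = L ^ (-c) * (1 - Real.log 2 / L) ^ (-c) := by
        rw [← Real.mul_rpow hL0.le (by linarith), mul_sub, mul_one, mul_div_cancel₀ _ hL0.ne']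
      rw [h2] at h1
      exact le_trans (mul_le_mul_of_nonneg_left
        (one_add_mul_le_one_sub_rpow_neg hs1 hc.le) (Real.rpow_nonneg hL0.le _)) h1
    -- assemble: `(X − M) η' ≥ (X − M) η (1 + c log2/L) ≥ X η + M`
    have hηdef : hbEta c N = L ^ (-c) := by rw [hLdef, hXdef]; rfl
    rw [hηdef] at hKN hη1 ⊢
    have hη0 : 0 ≤ L ^ (-c) := Real.rpow_nonneg hL0.le _
    have step : (X - M) * (L ^ (-c) * (1 + c * (Real.log 2 / L))) ≤
        (X - M) * Real.log ((X - M) / d) ^ (-c) := mul_le_mul_of_nonneg_left hη' hXM0.le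
    refine le_trans ?_ step
    -- need: X η + M ≤ (X − M) η (1 + c log2 / L), i.e.
    --       M + M η (1 + c log2/L) ≤ X η c log2 / L; use `K L ≤ X η` with K = (M(2+c)+1)/(c log 2)
    have hKL : ((M : ℝ) * (2 + c) + 1) * L ≤ X * L ^ (-c) * (c * Real.log 2) := by
      have := hKN
      rw [div_mul_eq_mul_div, div_le_iff₀ (by positivity)] at this
      linarith
    have hcs : c * (Real.log 2 / L) ≤ c := by
      have : Real.log 2 / L ≤ 1 := hs1.le
      nlinarith
    -- M η (1 + c log2/L) ≤ M (1 + c)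
    have hs0 : 0 ≤ c * (Real.log 2 / L) := mul_nonneg hc.le (div_nonneg hlog2.le hL0.le)
    have hA : (M : ℝ) * (L ^ (-c) * (1 + c * (Real.log 2 / L))) ≤ M * (1 + c) := by
      refine mul_le_mul_of_nonneg_left ?_ hM'
      nlinarith [hcs, hη1, hη0, hs0]
    -- X η c log2 / L ≥ M(2+c) + 1 ≥ M + M(1+c)
    have hB : (M : ℝ) * (2 + c) + 1 ≤ X * L ^ (-c) * (c * (Real.log 2 / L)) := by
      rw [show X * L ^ (-c) * (c * (Real.log 2 / L)) = X * L ^ (-c) * (c * Real.log 2) / L by ring,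
        le_div_iff₀ hL0]
      exact hKL
    nlinarith [hA, hB, hXM0, hη0, hs0]

/-! ### The upper class transfer -/

/-- `(w + ε/3)(1 + ε/(3(w + ε))) ≤ w + ε` for `w, ε > 0`. [folklore] -/
private theorem eps_budget {w ε : ℝ} (hw : 0 < w) (hε : 0 < ε) :
    (w + ε / 3) * (1 + ε / (3 * (w + ε))) ≤ w + ε := by
  have h1 : (w + ε / 3) / (w + ε) ≤ 1 := (div_le_one (by positivity)).mpr (by linarith)
  have h2 : (w + ε / 3) * (ε / (3 * (w + ε))) = (w + ε / 3) / (w + ε) * (ε / 3) := by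
    field_simp
  have h3 : (w + ε / 3) * (ε / (3 * (w + ε))) ≤ ε / 3 := by
    rw [h2]; nlinarith
  nlinarith [h3]

/-- **Upper class transfer**: from the class asymptotic
`residueClassPrimeCount X (log X)^{−c} d a b − w(d) M(X) = o(M(X))` [HeathBrownMoroz2004, Thm 2] for
an admissible class `(a, b) mod d` (`a, b < d`),
`#{(x, y) ∈ primePairs(X_N, η_N) : x ≡ a, y ≡ b (mod d)} ≤ (w(d) + ε) M(X_N)/d²` for all large `N`.
[cite: HeathBrownMoroz2004, Theorem 2 with HeathBrownActa2001, Theorem 1] -/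
theorem card_class_le_of_classAsymptotic {d a b : ℕ} (hd : 0 < d) (ha : a < d) (hb : b < d)
    {c σ₀ : ℝ} (hc : 0 < c) (hσ : 0 < σ₀)
    (hlo : IsLittleO atTop
      (fun X : ℝ => (residueClassPrimeCount X (Real.log X ^ (-c)) d a b : ℝ) -
        classWeight d * mainTerm c σ₀ X)
      (fun X : ℝ => mainTerm c σ₀ X)) :
    ∀ ε : ℝ, 0 < ε → ∀ᶠ N : ℕ in atTop,
      (#{xy ∈ primePairs (hbX N) (hbEta c N) | xy.1 ≡ a [MOD d] ∧ xy.2 ≡ b [MOD d]} : ℝ) ≤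
        (classWeight d + ε) * mainTerm c σ₀ (hbX N) / (d : ℝ) ^ 2 := by
  intro ε hε
  set w := classWeight d with hwdef
  have hw : 0 < w := classWeight_pos d
  have hd' : (0 : ℝ) < d := by exact_mod_cast hd
  have hMd : max a b < d := max_lt ha hb
  -- the HBM scale `X' = (X − max(a,b))/d → ∞`
  have hT : Tendsto (fun N : ℕ => (hbX N - ((max a b : ℕ) : ℝ)) / d) atTop atTop :=
    (tendsto_atTop_add_const_right _ _ tendsto_hbX).atTop_div_const hd'
  -- (1) the class asymptotic at `X'`, with `ε₁ = ε/3`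
  have h1 := hT.eventually (hlo.def (show (0 : ℝ) < ε / 3 by positivity))
  -- (2) the scale change, with `ε₂ = ε/(3(w+ε))`
  have hε₂ : (0 : ℝ) < ε / (3 * (w + ε)) := by positivity
  have h2 := tendsto_hbX.eventually
    ((tendsto_mainTerm_sub_div_mul_sq_div (c := c) hσ.ne' ((max a b : ℕ) : ℝ) hd').eventually
      (eventually_le_nhds (show (1 : ℝ) < 1 + ε / (3 * (w + ε)) by linarith)))
  -- (3) positivity of the main terms, (4) the top condition
  have h3 := tendsto_hbX.eventually_gt_atTop (1 : ℝ)
  have h3' := hT.eventually_gt_atTop (1 : ℝ)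
  have h4 := eventually_box_top_le hc hd hMd
  filter_upwards [h1, h2, h3, h3', h4] with N hN1 hN2 hX1 hX'1 htop
  set X := hbX N with hXdef
  set X' := (X - ((max a b : ℕ) : ℝ)) / d with hX'def
  have hMT : 0 < mainTerm c σ₀ X := mainTerm_pos hσ hX1
  have hMT' : 0 < mainTerm c σ₀ X' := mainTerm_pos hσ hX'1
  -- P ≤ Q
  have hPQ := card_class_le_residueClassPrimeCount hd ha hb (η := hbEta c N)
    (η' := Real.log X' ^ (-c)) htop
  have hPQ' : (#{xy ∈ primePairs X (hbEta c N) | xy.1 ≡ a [MOD d] ∧ xy.2 ≡ b [MOD d]} : ℝ) ≤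
      (residueClassPrimeCount X' (Real.log X' ^ (-c)) d a b : ℝ) := by exact_mod_cast hPQ
  -- Q ≤ (w + ε/3) M(X')
  rw [Real.norm_eq_abs, Real.norm_eq_abs, abs_of_pos hMT'] at hN1
  have hQ : (residueClassPrimeCount X' (Real.log X' ^ (-c)) d a b : ℝ) ≤
      (w + ε / 3) * mainTerm c σ₀ X' := by
    have := (abs_le.mp hN1).2
    linarith
  -- M(X') d² ≤ (1 + ε₂) M(X)
  have hscale : mainTerm c σ₀ X' * (d : ℝ) ^ 2 ≤ (1 + ε / (3 * (w + ε))) * mainTerm c σ₀ X := by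
    rwa [div_le_iff₀ hMT] at hN2
  have hd2 : (0 : ℝ) < (d : ℝ) ^ 2 := by positivity
  calc (#{xy ∈ primePairs X (hbEta c N) | xy.1 ≡ a [MOD d] ∧ xy.2 ≡ b [MOD d]} : ℝ)
      ≤ (w + ε / 3) * mainTerm c σ₀ X' := hPQ'.trans hQ
    _ = (w + ε / 3) * (mainTerm c σ₀ X' * (d : ℝ) ^ 2) / (d : ℝ) ^ 2 := by
        field_simp
    _ ≤ (w + ε / 3) * ((1 + ε / (3 * (w + ε))) * mainTerm c σ₀ X) / (d : ℝ) ^ 2 := by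
        gcongr
    _ = (w + ε / 3) * (1 + ε / (3 * (w + ε))) * mainTerm c σ₀ X / (d : ℝ) ^ 2 := by ring
    _ ≤ (w + ε) * mainTerm c σ₀ X / (d : ℝ) ^ 2 := by
        gcongr
        exact eps_budget hw hε

end Literature.NumberTheory.Sieve.CubicMinorant

end
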